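import Summits.KontsevichZagierPeriods.KontsevichZagierPeriods.Theses.LiftingCriteria
import Summits.KontsevichZagierPeriods.KontsevichZagierPeriods.Theorems.LiftingCriteriaDilationLiftAtOneTwistedDiagonal
import Summits.KontsevichZagierPeriods.KontsevichZagierPeriods.Theorems.LiftingCriteriaDilationLiftAtOneBakerSectorComplex
import Literature.NumberTheory.Transcendental.KZDilationRationalNormalForm

/-!
# `DilationLiftAtOne` holds for all one-variable rational KZ data (crux
stmt-KontsevichZagierPeriods-3571, route LiftingCriteria, line `registered`, registered stub
`stub_dimOneRational`)

**Theorem (unconditional, `dilationLiftAtOne_dimOneRational`).** Let `g_i = P_i/Q_i ∈ ℚ(x)`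
(`i < S`) be rational functions regular on `(a,b) ⊇ [0,1]` (rational `a < 0 < 1 < b`), `m_i, m₀ ∈ ℤ`
with `m₀ + Σ m_i ∫_0^1 g_i = 0`. Then the dilation G-function `w(ϖ) = m₀ + Σ m_i ∫_0^1 g_i(ϖ z) dz`
factors on `[0,1]` as `(ϖ − 1)·v_G(ϖ)` for ONE Nash cube function `G` in two variables — the
conclusion of the crux `DilationLiftAtOne` for these data (`T = 1`, `μ = 1`, `μ₀ = 0`). Proof:
(S3‴) `stub_dimOneRational` — common denominator and partial fractions over `ℚ̄ ⊂ ℂ` put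
`m₀ + Σ m_i g_i` in Baker normal form `ρ' + Σ_k (γ_k(−p_k + (p_k²+q_k²)x) + δ_k q_k)/((1−p_k x)²+(q_k x)²)`
with algebraic data (Literature `KZ.BakerSectorComplex.exists_complexSector_repr_rational`);
(S3″) `stub_bakerSectorComplex` — Baker's theorem in complex form lifts it to `(ϖ − 1)·∫ K(ϖ, ϖy) dy`;
(S4) `stub_twistedDiagonal` — the twisted-diagonal integral is one dilation function. This is the
dimension-one case of the crux in full (genus `0`: every one-variable rational absolute period), and
the first unconditional instance of the route's lifting criterion beyond single generators.
-/

noncomputable section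

open scoped BigOperators

namespace Summit.KontsevichZagierPeriods.LiftingCriteria.DilationLiftAtOne

/-- **Stub `stub_dimOneRational` of the registered skeleton of crux stmt-KontsevichZagierPeriods-3571
(line `registered`, reshape 3 by lead c2): one-variable rational KZ combinations are represented by
complex Baker-sector data.** Verbatim the registered signature; proof =
`Literature.NumberTheory.Transcendental.KZ.BakerSectorComplex.exists_complexSector_repr_rational`.
[cite: Baker1975, Theorem 2.1] -/
theorem stub_dimOneRational :
    ∀ (S : ℕ) (P Q : Fin S → Polynomial ℚ) (a b : ℚ), (a:ℝ) < 0 → 1 < (b:ℝ) → (∀ i, ∀ x ∈ Set.Ioo (a:ℝ) b, Polynomial.aeval x (Q i) ≠ 0) → ∀ (m : Fin S → ℤ) (m₀ : ℤ), ∃ (ρ : ℝ → ℝ) (A : ℕ) (p q γ δ : Fin A → ℝ), Literature.NumberTheory.Transcendental.IsSemialgebraicFunOn ℚ {t : Fin 1 → ℝ | t 0 ∈ Set.Ioo (a:ℝ) b} (fun t => ρ (t 0)) ∧ (∀ x ∈ Set.Ioo (a:ℝ) b, AnalyticAt ℝ ρ x) ∧ (∀ k, IsAlgebraic ℚ (p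 k)) ∧ (∀ k, IsAlgebraic ℚ (q k)) ∧ (∀ k, IsAlgebraic ℚ (γ k)) ∧ (∀ k, IsAlgebraic ℚ (δ k)) ∧ (∀ k, ∀ x ∈ Set.Ioo (a:ℝ) b, 0 < 1 - p k * x ∨ q k * x ≠ 0) ∧ ∀ ϖ ∈ Set.Icc (0:ℝ) 1, (m₀ : ℝ) + ∑ i, (m i : ℝ) * (∫ z in Set.pi Set.univ (fun _ : Fin 1 => Set.Icc (0:ℝ) 1), Polynomial.aeval ((ϖ • z) 0) (P i) / Polynomial.aeval ((ϖ • z) 0) (Q i)) = ∫ z in Set.pi Set.univ (fun _ : Fin 1 => Set.Icc (0:ℝ) 1), (deriv ρ ((ϖ • z) 0) + ∑ k, (γ k * (-p k + (p k ^ 2 + q k ^ 2) * ((ϖ • z) 0)) + δ k * q k) / ((1 - p k * ((ϖ • z) 0)) ^ 2 + (q k * ((ϖ • z) 0)) ^ 2)) :=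
  fun S P Q a b ha hb hQ m m₀ =>
    Literature.NumberTheory.Transcendental.KZ.BakerSectorComplex.exists_complexSector_repr_rational
      S P Q a b ha hb hQ m m₀

/-- **`DilationLiftAtOne` for one-variable rational data (unconditional).** See the module
docstring: for `g_i = P_i/Q_i ∈ ℚ(x)` regular on `(a,b) ⊇ [0,1]` and an integer relation
`m₀ + Σ m_i ∫_0^1 g_i = 0`, the dilation function `m₀ + Σ m_i v_{g_i}` lies in `(ϖ − 1)·D` on `[0,1]`
with ONE Nash cube function `G` of two variables, `μ = 1`, `μ₀ = 0` — the conclusion of the crux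
for these data. [cite: KontsevichZagier2001, §1.2] -/
theorem dilationLiftAtOne_dimOneRational (S : ℕ) (P Q : Fin S → Polynomial ℚ) (a b : ℚ)
    (ha : (a:ℝ) < 0) (hb : 1 < (b:ℝ))
    (hQ : ∀ i, ∀ x ∈ Set.Ioo (a:ℝ) b, Polynomial.aeval x (Q i) ≠ 0) (m : Fin S → ℤ) (m₀ : ℤ)
    (hsum : (m₀ : ℝ) + ∑ i, (m i : ℝ) *
      (∫ z in Set.pi Set.univ (fun _ : Fin 1 => Set.Icc (0:ℝ) 1),
        Polynomial.aeval (((1:ℝ) • z) 0) (P i) / Polynomial.aeval (((1:ℝ) • z) 0) (Q i)) = 0) :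
    ∃ (T : ℕ) (d : Fin T → ℕ) (G : (j : Fin T) → (Fin (d j) → ℝ) → ℝ)
      (V : (j : Fin T) → Set (Fin (d j) → ℝ)) (μ : Fin T → Polynomial ℝ) (μ₀ : Polynomial ℝ),
      (∀ j, IsOpen (V j) ∧ Set.pi Set.univ (fun _ : Fin (d j) => Set.Icc (0:ℝ) 1) ⊆ (V j) ∧
        Literature.NumberTheory.Transcendental.IsSemialgebraicFunOn ℚ (V j) (G j) ∧
        AnalyticOnNhd ℝ (G j) (V j)) ∧
      (∀ j k, IsAlgebraic ℚ ((μ j).coeff k)) ∧ (∀ k, IsAlgebraic ℚ (μ₀.coeff k)) ∧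
      ∀ ϖ ∈ Set.Icc (0:ℝ) 1, (m₀ : ℝ) + ∑ i, (m i : ℝ) *
          (∫ z in Set.pi Set.univ (fun _ : Fin 1 => Set.Icc (0:ℝ) 1),
            Polynomial.aeval ((ϖ • z) 0) (P i) / Polynomial.aeval ((ϖ • z) 0) (Q i)) =
        (ϖ - 1) * (μ₀.eval ϖ + ∑ j, (μ j).eval ϖ *
          (∫ z in Set.pi Set.univ (fun _ : Fin (d j) => Set.Icc (0:ℝ) 1), G j (ϖ • z))) := by
  classical
  -- (S3‴) the rational data are complex Baker-sector data
  obtain ⟨ρ, A, p, q, γ, δ, hρs, hρa, hp, hq, hγ, hδ, hslit, hrepr⟩ :=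
    stub_dimOneRational S P Q a b ha hb hQ m m₀
  have h1 : (∫ z in Set.pi Set.univ (fun _ : Fin 1 => Set.Icc (0:ℝ) 1),
      (deriv ρ (((1:ℝ) • z) 0) + ∑ k, (γ k * (-p k + (p k ^ 2 + q k ^ 2) * (((1:ℝ) • z) 0)) +
        δ k * q k) / ((1 - p k * (((1:ℝ) • z) 0)) ^ 2 + (q k * (((1:ℝ) • z) 0)) ^ 2))) = 0 := by
    rw [← hrepr 1 ⟨zero_le_one, le_rfl⟩]
    exact hsum
  -- (S3″) the complex Baker-sector lift, one kernel on `[0,1]`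
  obtain ⟨K, V, hVo, hVc, hKs, hKa, hid⟩ :=
    stub_bakerSectorComplex a b ha hb ρ hρs hρa A p q γ δ hp hq hγ hδ hslit h1
  -- (S4) the twisted-diagonal integral is one dilation function `v_G`
  obtain ⟨G, V', hG, hGK⟩ := stub_twistedDiagonal 1 K V hVo hVc hKs hKa
  refine ⟨1, fun _ => 1 + 1, fun _ => G, fun _ => V', fun _ => 1, 0, fun _ => hG, ?_, ?_, ?_⟩
  · intro j k
    rw [Polynomial.coeff_one]
    split_ifs
    · exact isAlgebraic_one
    · exact isAlgebraic_zero
  · intro k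
    rw [Polynomial.coeff_zero]
    exact isAlgebraic_zero
  · intro ϖ hϖ
    rw [hrepr ϖ hϖ, hid ϖ hϖ, hGK ϖ hϖ]
    simp

end Summit.KontsevichZagierPeriods.LiftingCriteria.DilationLiftAtOne
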